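import Summits.ResolutionOfSingularities.ResolutionOfSingularities.Theorems.MarkedTransferCampaignW46ThreefoldsGammaFreeGlobalFamilyStep
import Summits.ResolutionOfSingularities.ResolutionOfSingularities.Theorems.MarkedTransferCampaignW46ThreefoldsGammaFreeGlobalSNCAtFamily
import Summits.ResolutionOfSingularities.ResolutionOfSingularities.Theorems.MarkedTransferCampaignW46ThreefoldsGammaFreeGlobalMeasure
import Summits.ResolutionOfSingularities.ResolutionOfSingularities.Theorems.MarkedTransferCampaignW46ThreefoldsGammaFreeGlobalIntersection
import Literature.AlgebraicGeometry.Resolution.StalkIdealLemmas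
import Literature.AlgebraicGeometry.Resolution.PermissibleCentres
import Literature.AlgebraicGeometry.Resolution.SncStrata
import Literature.AlgebraicGeometry.Resolution.DivisorialPartLemmas
import Literature.AlgebraicGeometry.Resolution.RegularBlowup
import Literature.AlgebraicGeometry.Resolution.PointCentrePermissible
import Mathlib.RingTheory.Nakayama
import HarnessLib

/-!
# [OURS · L1 W4.6 rung (ii), dimension ladder] THE BRANCHES AT A POINT OVER THE BLOWN-UP POINT: uniqueness of the point of a lifted
# branch, transversality to the exceptional curve, and the NOETHER INEQUALITY for the local intersection number
# (brick B10b-loc of rung (ii-2) `GammaFreeGlobalOrderReductionDimLE p 2`)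

Cell res-hironaka, LADDER-RESOLUTION rung L (D-0089), slot W4.6, rung (ii) (dimension ladder, res-L1-type-o1 p496755); seat
res-D-pv-049 AS res-L1-s46-pv-11 (holder of rung (ii-2); architecture v2, STATUS 2026-08-27T05:4xZ). Host route MarkedTransfer,
host item `HypersurfaceOrderReductionDimLeThree` (stmt-ResolutionOfSingularities-16156); proposed `--kind proof --supports` it
`--as helper`. Everything here is OURS commutative algebra / scheme theory; nothing of H. Hironaka's manuscript [Hironaka2017] is
asserted. AI-written; AI review is weaker than expert review.

## Setting and what is proved

`π : X′ → X` the blowing up of the regular integral locally Noetherian `X` at a closed point `x`; `j : C ↪ X′` a closed immersion of an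
integral scheme such that `j ≫ π : C ↪ X` is a closed immersion too (a branch of the boundary LIFTED through the blow-up, brick B8c —
the case of a branch regular at `x`), `c ∈ C` the point over `x = π(j c)`. Write `S = 𝒪_{X′,jc}`, `R = 𝒪_{X,x}`, `D = 𝒪_{C,c}`,
`θ = j♯_c : S ↠ D` (kernel `𝔭′`, the stalk of the prime-divisor ideal of `cl j(η_C)`), `φ = π♯ : R → S`, `θ ∘ φ = (j ≫ π)♯_c : R ↠ D`.

* `eq_of_specializes_lift` (U1) — a point over `x` to which `j(η_C)` specialises IS `j c`.
* `stalkIdeal_sup_stalkIdeal_excGen_eq_maximalIdeal` (U2) — `𝔭′ + 𝔭_E = 𝔪_S` (`𝔭_E = 𝔪_R S` the stalk of the exceptional ideal):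
  the lifted branch is transversal to the exceptional curve; `pairLength_lift_excGen`: their local intersection number is `1`.
* `pairLength_lift_add_one_le` (U3, **Noether's inequality**) — for any other codimension-one point `ζ″ ⤳ j c` not on `E`:
  `i_{jc}(cl j η_C, cl ζ″) + 1 ≤ i_x(cl π j η_C, cl π ζ″)`. Proof without charts: both sides are lengths of quotients of the branch
  ring `D` (`length_quotient_sup_eq_of_surjective`), `φ(𝔭_{πζ″}) ⊆ 𝔭″ ∩ (t) = (t g″)` (`t ∤ g″` as `ζ″ ≠ η_E`), and
  `λ(D/aI) ≥ λ(D/I) + 1` for `a ∈ 𝔪_D`, `I ≠ 0` finitely generated (Nakayama; `length_quotient_add_one_le_of_mul`).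
* Dictionary lemmas: `comap_stalkMap_stalkIdeal_primeDivisorIdeal` (`φ⁻¹ 𝔭_{ζ′} = 𝔭_{π ζ′}`), `eq_of_stalkIdeal_primeDivisorIdeal_eq`,
  `specializes_iff_exists_eq_of_isClosedImmersion`, `mem_regularLocus_iff_of_isClosedImmersion`.

## Sources

* R. Hartshorne, *Algebraic Geometry* (1977), Ch. V Prop. 3.6, Cor. 3.7 (behaviour of intersection numbers under the blowing up
  of a point: `π*C = C̃ + r E`, `C̃.E = r`, Noether's formula). [Hartshorne1977]
* The Stacks Project, Tags 01J7 (points of `Spec 𝒪_{X,x}`), 02OS, 00DV (Nakayama). [StacksProject]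
* H. Hironaka, ms. 2017-03-23, Def. 2.1 p.5 — scope only, under adjudication, not cited as fact. [Hironaka2017]
-/

noncomputable section

set_option linter.dupNamespace false -- mandated namespace of this single-conjunct summit

open CategoryTheory AlgebraicGeometry TopologicalSpace IsLocalRing Topology

namespace Summit.ResolutionOfSingularities.ResolutionOfSingularities.Theorems

namespace CampaignW46

open Literature.AlgebraicGeometry.Resolution
open Scheme.IdealSheafData

universe u

/-! ## §1 Commutative algebra: lengths of quotients of a quotient ring -/

section Algebra

variable {R D : Type u} [CommRing R] [CommRing D]

/-- **Lengths through a surjection.** For `ψ : R ↠ D` with kernel `P` and any ideal `Q`: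
`λ_R(R/(P + Q)) = λ_D(D/ψ(Q)D)` (`R/(P+Q) ≅ D/ψ(Q)D` as `R`-algebras, and lengths over `R` and `D` of a `D`-module agree).
[folklore] -/
theorem length_quotient_sup_eq_of_surjective (ψ : R →+* D) (hψ : Function.Surjective ψ) {P : Ideal R}
    (hP : RingHom.ker ψ = P) (Q : Ideal R) :
    Module.length R (R ⧸ (P ⊔ Q)) = Module.length D (D ⧸ Q.map ψ) := by
  letI := ψ.toAlgebra
  have h1 : Module.length R (D ⧸ Q.map ψ) = Module.length D (D ⧸ Q.map ψ) :=
    Module.length_eq_of_surjective (R := D) (S := R) (M := D ⧸ Q.map ψ) hψ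
  let f : R →ₐ[R] D ⧸ Q.map ψ := Algebra.ofId R _
  have hf' : ∀ r, f r = Ideal.Quotient.mk (Q.map ψ) (ψ r) := fun _ => rfl
  have hf : Function.Surjective f := by
    intro b
    obtain ⟨d, rfl⟩ := Ideal.Quotient.mk_surjective b
    obtain ⟨r, rfl⟩ := hψ d
    exact ⟨r, hf' r⟩
  have hker : RingHom.ker f = P ⊔ Q := by
    ext r
    rw [RingHom.mem_ker, hf', Ideal.Quotient.eq_zero_iff_mem, ← Ideal.mem_comap, Ideal.comap_map_of_surjective ψ hψ,
      ← RingHom.ker_eq_comap_bot, hP, sup_comm]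
  let e : (R ⧸ (P ⊔ Q)) ≃ₐ[R] D ⧸ Q.map ψ :=
    (Ideal.quotientEquivAlgOfEq R hker.symm).trans (Ideal.quotientKerAlgEquivOfSurjective hf)
  rw [e.toLinearEquiv.length_eq, h1]

/-- Lengths of cyclic modules are antitone in the ideal: `J₁ ≤ J₂ → λ(D/J₂) ≤ λ(D/J₁)`. [folklore] -/
theorem length_quotient_antitone {J₁ J₂ : Ideal D} (h : J₁ ≤ J₂) :
    Module.length D (D ⧸ J₂) ≤ Module.length D (D ⧸ J₁) :=
  Module.length_le_of_surjective (Submodule.factor h) (Submodule.factor_surjective h)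

/-- **Multiplying a non-zero finitely generated ideal by a non-unit raises the colength** (Nakayama): in a local ring, for
`I ≠ 0` finitely generated and `a ∈ 𝔪`: `λ(D/I) + 1 ≤ λ(D/aI)` (`0 → I/aI → D/aI → D/I → 0` with `I/aI ≠ 0`).
[cite: StacksProject, Tag 00DV] -/
theorem length_quotient_add_one_le_of_mul [IsLocalRing D] {I : Ideal D} (hI : I.FG) (hI0 : I ≠ ⊥) {a : D}
    (ha : a ∈ maximalIdeal D) :
    Module.length D (D ⧸ I) + 1 ≤ Module.length D (D ⧸ Ideal.span {a} * I) := by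
  set K : Ideal D := Ideal.span {a} * I with hK
  have hKI : K ≤ I := Ideal.mul_le_left
  -- the submodule `I/aI ⊆ D/aI`
  set N : Submodule D (D ⧸ K) := Submodule.map K.mkQ I with hN
  have hexact := Module.length_eq_add_of_exact N.subtype N.mkQ N.injective_subtype N.mkQ_surjective
    (LinearMap.exact_subtype_mkQ N)
  have hquot : Module.length D ((D ⧸ K) ⧸ N) = Module.length D (D ⧸ I) :=
    (Submodule.quotientQuotientEquivQuotient K I hKI).length_eq
  have hN0 : N ≠ ⊥ := by
    intro h
    rw [hN, ← LinearMap.le_ker_iff_map, Submodule.ker_mkQ] at h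
    apply hI0
    refine Submodule.eq_bot_of_le_smul_of_le_jacobson_bot (Ideal.span {a}) I hI ?_ ?_
    · rw [Ideal.smul_eq_mul]; exact h
    · rw [IsLocalRing.jacobson_eq_maximalIdeal ⊥ bot_ne_top, Ideal.span_le, Set.singleton_subset_iff]
      exact ha
  have hN1 : 1 ≤ Module.length D N := by
    rw [Order.one_le_iff_ne_zero, Ne, Module.length_eq_zero_iff]
    intro hsub
    exact hN0 (Submodule.eq_bot_iff _ |>.mpr fun z hz => by
      have := hsub.elim ⟨z, hz⟩ ⟨0, N.zero_mem⟩
      exact congrArg Subtype.val this)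
  rw [hexact, hquot, add_comm]
  exact add_le_add_left hN1 _

/-- In a local ring a surjective local homomorphism maps the maximal ideal ONTO the maximal ideal. [folklore] -/
theorem map_maximalIdeal_eq_of_surjective [IsLocalRing R] [IsLocalRing D] (f : R →+* D) [IsLocalHom f]
    (hf : Function.Surjective f) : (maximalIdeal R).map f = maximalIdeal D := by
  refine le_antisymm (IsLocalRing.map_maximalIdeal_le f) fun b hb => ?_
  obtain ⟨a, rfl⟩ := hf b
  refine Ideal.mem_map_of_mem f ((mem_maximalIdeal _).mpr fun ha => ?_)
  exact (mem_maximalIdeal _).mp hb (ha.map f)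

/-- For non-associated primes `t ∤ g` of a commutative ring: `(g) ∩ (t) ⊆ (t g)`. [folklore] -/
theorem span_singleton_inf_le_span_mul {S : Type u} [CommRing S] {t g : S} (ht : Prime t) (htg : ¬ t ∣ g) :
    Ideal.span {g} ⊓ Ideal.span {t} ≤ Ideal.span {t * g} := by
  intro z hz
  obtain ⟨hzg, hzt⟩ := Submodule.mem_inf.mp hz
  obtain ⟨w, rfl⟩ := Ideal.mem_span_singleton.mp hzg
  rcases ht.dvd_or_dvd (Ideal.mem_span_singleton.mp hzt) with h | ⟨w', rfl⟩
  · exact absurd h htg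
  · exact Ideal.mem_span_singleton.mpr ⟨w', by ring⟩

end Algebra

/-! ## §2 Dictionary: prime-divisor stalks under morphisms and closed immersions -/

section Dictionary

variable {X Y : Scheme.{u}}

/-- **Naturality of `𝔭_ζ` under morphisms**: `(f♯_p)⁻¹ 𝔭_ζ = 𝔭_{f ζ}` for `ζ ⤳ p` (tree `CuspEmbeddedSequenceCounterexample`, there
private). [cite: StacksProject, Tag 01J7] -/
theorem comap_stalkMap_primeOfSpecializes (f : X ⟶ Y) {ζ p : X} (h : ζ ⤳ p) :
    (primeOfSpecializes h).comap (f.stalkMap p).hom = primeOfSpecializes (f.base.hom.map_specializes h) := by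
  change ((maximalIdeal (X.presheaf.stalk ζ)).comap (X.presheaf.stalkSpecializes h).hom).comap (f.stalkMap p).hom =
    (maximalIdeal (Y.presheaf.stalk (f ζ))).comap (Y.presheaf.stalkSpecializes (f.base.hom.map_specializes h)).hom
  rw [← IsLocalRing.maximalIdeal_comap (f.stalkMap ζ).hom, Ideal.comap_comap, Ideal.comap_comap,
    ← CommRingCat.hom_comp, ← CommRingCat.hom_comp, Scheme.Hom.stalkSpecializes_stalkMap]

/-- **`(f♯_p)⁻¹ (𝓘_{cl ζ})_p = (𝓘_{cl f ζ})_{f p}`** for `ζ ⤳ p`. [cite: StacksProject, Tag 01J7] -/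
theorem comap_stalkMap_stalkIdeal_primeDivisorIdeal (f : X ⟶ Y) {ζ p : X} (h : ζ ⤳ p) :
    (stalkIdeal (primeDivisorIdeal ζ) p).comap (f.stalkMap p).hom = stalkIdeal (primeDivisorIdeal (f ζ)) (f p) := by
  rw [stalkIdeal_primeDivisorIdeal h, stalkIdeal_primeDivisorIdeal (h.map f.continuous), comap_stalkMap_primeOfSpecializes]

/-- Two generisations of `p` with the same prime `(𝓘_{cl ζ})_p` are equal. [cite: StacksProject, Tag 01J7] -/
theorem eq_of_stalkIdeal_primeDivisorIdeal_le {ζ₁ ζ₂ p : X} (h₁ : ζ₁ ⤳ p) (h₂ : ζ₂ ⤳ p)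
    (hle : stalkIdeal (primeDivisorIdeal ζ₁) p ≤ stalkIdeal (primeDivisorIdeal ζ₂) p) : ζ₁ ⤳ ζ₂ := by
  rw [stalkIdeal_primeDivisorIdeal h₁, stalkIdeal_primeDivisorIdeal h₂] at hle
  exact specializes_of_primeOfSpecializes_le h₂ h₁ hle

/-- For a closed immersion `j : C ↪ Y` of an irreducible scheme: `j(η_C) ⤳ y ↔ y ∈ j(C)`. [folklore] -/
theorem specializes_iff_exists_eq_of_isClosedImmersion {C : Scheme.{u}} [IrreducibleSpace C] (j : C ⟶ Y)
    [IsClosedImmersion j] (y : Y) : j (genericPoint C) ⤳ y ↔ ∃ c, j c = y := by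
  have hrange : closure ({j (genericPoint C)} : Set Y) = Set.range j := by
    rw [← Set.image_singleton, j.isClosedEmbedding.closure_image_eq, genericPoint_closure, Set.image_univ]
  rw [specializes_iff_mem_closure, hrange, Set.mem_range]

/-- **Regular points of a closed subscheme through the ambient local ring**: for a closed immersion `i : C ↪ X` of an integral
scheme and `c ∈ C`, `𝒪_{C,c} ≅ 𝒪_{X,ic}/(𝓘_{cl i η_C})_{ic}`, so `c` is a regular point of `C` iff that quotient is a regular local
ring. [folklore] -/
theorem mem_regularLocus_iff_of_isClosedImmersion {C : Scheme.{u}} [IsIntegral C] (i : C ⟶ X) [IsClosedImmersion i] (c : C) :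
    c ∈ Scheme.regularLocus C ↔
      IsRegularLocalRing (X.presheaf.stalk (i c) ⧸ stalkIdeal (primeDivisorIdeal (i (genericPoint C))) (i c)) := by
  have hsurj : Function.Surjective (i.stalkMap c).hom := i.stalkMap_surjective c
  have hker : RingHom.ker (i.stalkMap c).hom = stalkIdeal (primeDivisorIdeal (i (genericPoint C))) (i c) := by
    rw [← ker_eq_primeDivisorIdeal_of_isIntegral i, stalkIdeal_ker_eq_ker_stalkMap i c]
  let e : (X.presheaf.stalk (i c) ⧸ stalkIdeal (primeDivisorIdeal (i (genericPoint C))) (i c)) ≃+* C.presheaf.stalk c :=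
    (Ideal.quotEquivOfEq hker.symm).trans (RingHom.quotientKerEquivOfSurjective hsurj)
  exact ⟨fun h => by haveI : IsRegularLocalRing (C.presheaf.stalk c) := h; exact IsRegularLocalRing.of_ringEquiv e.symm,
    fun h => by haveI := h; exact IsRegularLocalRing.of_ringEquiv e⟩

end Dictionary

/-! ## §3 The lifted branch at its point over the centre -/

section Lift

variable {X X' C : Scheme.{u}} [IsIntegral X] [IsLocallyNoetherian X] (hX : Scheme.IsRegular X) [IsIntegral C]
  {π : X' ⟶ X} (j : C ⟶ X') [IsClosedImmersion j] [IsClosedImmersion (j ≫ π)] {c : C}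
  (hx : IsClosed ({π (j c)} : Set X)) (hxne : ({π (j c)} : Set X) ≠ Set.univ)
  (hπ : IsBlowup π (vanishingIdeal ⟨{π (j c)}, hx⟩))

omit [IsIntegral X] [IsLocallyNoetherian X] [IsIntegral C] [IsClosedImmersion j] in
/-- **(U1) The point over `x` on a lifted branch is unique**: if `p′` lies over `x = π(j c)` and `j(η_C) ⤳ p′` then `p′ = j c`
(`p′ ∈ cl j(η_C) = j(C)` and `j ≫ π` is injective). [folklore] -/
theorem eq_of_specializes_lift [IrreducibleSpace C] [IsClosedImmersion j] {p' : X'} (hp' : π p' = π (j c))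
    (hsp : j (genericPoint C) ⤳ p') : p' = j c := by
  obtain ⟨c', rfl⟩ := (specializes_iff_exists_eq_of_isClosedImmersion j p').mp hsp
  have h : (j ≫ π) c' = (j ≫ π) c := by rw [Scheme.Hom.comp_apply, Scheme.Hom.comp_apply]; exact hp'
  rw [(j ≫ π).isClosedEmbedding.injective h]

/-- The kernel of `θ = j♯_c` is the stalk `𝔭′` of the prime-divisor ideal of the lifted branch. [folklore] -/
theorem ker_stalkMap_eq_stalkIdeal :
    RingHom.ker (j.stalkMap c).hom = stalkIdeal (primeDivisorIdeal (j (genericPoint C))) (j c) := by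
  rw [← ker_eq_primeDivisorIdeal_of_isIntegral j, stalkIdeal_ker_eq_ker_stalkMap j c]

omit [IsIntegral X] [IsIntegral C] [IsClosedImmersion j] [IsClosedImmersion (j ≫ π)] in
include hX hπ in
/-- The stalk at `j c` of the prime-divisor ideal of the exceptional generic point is `𝔪_R S`. [cite: Liu2002, Thm. 8.1.19 (b)] -/
theorem stalkIdeal_excGen_eq_map_maximalIdeal {η : X'} (hη : IsGenericPoint η (π ⁻¹' ({π (j c)} : Set X))) :
    stalkIdeal (primeDivisorIdeal η) (j c) = (maximalIdeal (X.presheaf.stalk (π (j c)))).map (π.stalkMap (j c)).hom := by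
  rw [primeDivisorIdeal_excGen_eq_comap hX hx hπ hη, stalkIdeal_comap_eq_map_stalkMap, stalkIdeal_vanishingIdeal_singleton hx]

omit [IsIntegral X] in
include hX hπ in
/-- **(U2) The lifted branch is transversal to the exceptional curve**: `𝔭′ + 𝔭_E = 𝔪_S` at `j c` (`θ` maps `𝔪_S` and
`𝔪_R S` both onto `𝔪_D`). [cite: Hartshorne1977, Ch. V Prop. 3.6] -/
theorem stalkIdeal_sup_stalkIdeal_excGen_eq_maximalIdeal {η : X'} (hη : IsGenericPoint η (π ⁻¹' ({π (j c)} : Set X))) :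
    stalkIdeal (primeDivisorIdeal (j (genericPoint C))) (j c) ⊔ stalkIdeal (primeDivisorIdeal η) (j c) =
      maximalIdeal (X'.presheaf.stalk (j c)) := by
  have hcomp : ((j ≫ π).stalkMap c).hom = (j.stalkMap c).hom.comp (π.stalkMap (j c)).hom := by
    rw [Scheme.Hom.stalkMap_comp]; rfl
  have hsurj' : Function.Surjective ((j.stalkMap c).hom.comp (π.stalkMap (j c)).hom) := by
    rw [← hcomp]; exact (j ≫ π).stalkMap_surjective c
  haveI hloc : IsLocalHom ((j.stalkMap c).hom.comp (π.stalkMap (j c)).hom) := inferInstance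
  haveI hlocθ : IsLocalHom (j.stalkMap c).hom := inferInstance
  haveI hlocφ : IsLocalHom (π.stalkMap (j c)).hom := inferInstance
  have hθsurj : Function.Surjective (j.stalkMap c).hom := j.stalkMap_surjective c
  set θ := (j.stalkMap c).hom with hθ
  set φ := (π.stalkMap (j c)).hom with hφ
  rw [← ker_stalkMap_eq_stalkIdeal j, stalkIdeal_excGen_eq_map_maximalIdeal hX j hx hπ hη]
  apply le_antisymm
  · refine sup_le (IsLocalRing.le_maximalIdeal (RingHom.ker_ne_top θ)) (IsLocalRing.map_maximalIdeal_le φ)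
  · intro s hs
    have hθs : θ s ∈ (maximalIdeal _).map (θ.comp φ) := by
      rw [map_maximalIdeal_eq_of_surjective (θ.comp φ) hsurj', ← map_maximalIdeal_eq_of_surjective θ hθsurj]
      exact Ideal.mem_map_of_mem θ hs
    rw [← Ideal.map_map] at hθs
    obtain ⟨s', hs', hθs'⟩ := (Ideal.mem_map_iff_of_surjective θ hθsurj).mp hθs
    refine Submodule.mem_sup.mpr ⟨s - s', ?_, s', hs', by ring⟩
    rw [RingHom.mem_ker, map_sub, hθs', sub_self]

omit [IsIntegral X] in
include hX hπ in
/-- **The local intersection number of a lifted branch with the exceptional curve is `1`.** [cite: Hartshorne1977, Ch. V Prop. 3.6] -/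
theorem pairLength_lift_excGen {η : X'} (hη : IsGenericPoint η (π ⁻¹' ({π (j c)} : Set X))) :
    pairLength (j (genericPoint C)) η (j c) = 1 := by
  rw [pairLength_def, stalkIdeal_sup_stalkIdeal_excGen_eq_maximalIdeal hX j hx hπ hη]
  exact (length_quotient_eq_one_iff _).mpr rfl

include hX hxne hπ in
/-- **(U3) Noether's inequality for a lifted branch.** For a codimension-one point `ζ″ ⤳ j c` of `X′` off the exceptional curve and
different from the generic point of the lifted branch: `i_{jc}(cl j η_C, cl ζ″) + 1 ≤ i_x(cl π j η_C, cl π ζ″)` — the local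
intersection number with any other branch drops by at least one under the blow-up. [cite: Hartshorne1977, Ch. V Cor. 3.7] -/
theorem pairLength_lift_add_one_le (hc : π (j (genericPoint C)) ≠ π (j c))
    (hcoh : Order.coheight (π (j (genericPoint C))) = 1) {ζ'' : X'} (hζ''c : ζ'' ⤳ j c)
    (hcoh'' : Order.coheight ζ'' = 1) (hζ''x : π ζ'' ≠ π (j c)) (hne : ζ'' ≠ j (genericPoint C)) :
    pairLength (j (genericPoint C)) ζ'' (j c) + 1 ≤ pairLength (π (j (genericPoint C))) (π ζ'') (π (j c)) := by
  -- notation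
  have hcomp : ((j ≫ π).stalkMap c).hom = (j.stalkMap c).hom.comp (π.stalkMap (j c)).hom := by
    rw [Scheme.Hom.stalkMap_comp]; rfl
  have hsurj' : Function.Surjective ((j.stalkMap c).hom.comp (π.stalkMap (j c)).hom) := by
    rw [← hcomp]; exact (j ≫ π).stalkMap_surjective c
  haveI hlocθ : IsLocalHom (j.stalkMap c).hom := inferInstance
  haveI hlocφ : IsLocalHom (π.stalkMap (j c)).hom := inferInstance
  have hθsurj : Function.Surjective (j.stalkMap c).hom := j.stalkMap_surjective c
  have hkerθ0 := ker_stalkMap_eq_stalkIdeal j (c := c)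
  set S := X'.presheaf.stalk (j c)
  set R := X.presheaf.stalk (π (j c))
  set D := C.presheaf.stalk c
  set θ := (j.stalkMap c).hom with hθ
  set φ := (π.stalkMap (j c)).hom with hφ
  set ζ' := j (genericPoint C) with hζ'
  -- regularity of `X′`, the exceptional generic point
  have hX' : Scheme.IsRegular X' :=
    hπ.isRegular_of_isRegular_subscheme hX (isRegular_subscheme_vanishingIdeal_singleton hx)
  have hUFD' := Scheme.IsRegular.uniqueFactorizationMonoid_stalk hX'
  haveI : IsIntegral X' := hπ.isIntegral (vanishingIdeal_singleton_ne_bot hx hxne)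
  obtain ⟨η, hη⟩ := exists_isGenericPoint_exc hX hx hxne hπ
  have hηx : π η = π (j c) := apply_excGen_eq hη
  have hηc : η ⤳ j c := hη.specializes rfl
  have hcohη : Order.coheight η = 1 := coheight_excGen hX hx hxne hπ hη
  have hζ'c : ζ' ⤳ j c := (genericPoint_specializes c).map j.continuous
  have hcohζ' : Order.coheight ζ' = 1 := by rw [coheight_eq_of_apply_ne hx hπ hc, hcoh]
  -- generators of the three height-one primes at `j c`
  obtain ⟨g, hg, hP'⟩ := exists_stalkIdeal_primeDivisorIdeal_eq_span hUFD' hζ'c hcohζ'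
  obtain ⟨t, ht, hPE⟩ := exists_stalkIdeal_primeDivisorIdeal_eq_span hUFD' hηc hcohη
  obtain ⟨g'', hg'', hP''⟩ := exists_stalkIdeal_primeDivisorIdeal_eq_span hUFD' hζ''c hcoh''
  have hkerθ : RingHom.ker θ = Ideal.span {g} := by rw [hkerθ0, hP']
  have hPE' : (maximalIdeal R).map φ = Ideal.span {t} := by
    rw [← hPE, stalkIdeal_excGen_eq_map_maximalIdeal hX j hx hπ hη]
  -- `t ∤ g″` (else `ζ″ ⤳ η`, two distinct codimension-one points) and `g ∤ g″` (else `ζ″ ⤳ ζ′`)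
  have htg : ¬ t ∣ g'' := by
    intro h
    have hle : stalkIdeal (primeDivisorIdeal ζ'') (j c) ≤ stalkIdeal (primeDivisorIdeal η) (j c) := by
      rw [hP'', hPE]; exact Ideal.span_singleton_le_span_singleton.mpr h
    have hsp := eq_of_stalkIdeal_primeDivisorIdeal_le hζ''c hηc hle
    exact not_specializes_of_coheight_eq_one hcoh'' hcohη (fun e => hζ''x (by rw [e, hηx])) hsp
  have hgg : ¬ g ∣ g'' := by
    intro h
    have hle : stalkIdeal (primeDivisorIdeal ζ'') (j c) ≤ stalkIdeal (primeDivisorIdeal ζ') (j c) := by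
      rw [hP'', hP']; exact Ideal.span_singleton_le_span_singleton.mpr h
    have hsp := eq_of_stalkIdeal_primeDivisorIdeal_le hζ''c hζ'c hle
    exact not_specializes_of_coheight_eq_one hcoh'' hcohζ' hne hsp
  -- both sides as lengths over the branch ring `D`
  have hLHS : pairLength ζ' ζ'' (j c) = Module.length D (D ⧸ (Ideal.span {g''}).map θ) := by
    rw [pairLength_def, hP', hP'', ← hkerθ]
    exact length_quotient_sup_eq_of_surjective θ hθsurj rfl _
  have hRHS : pairLength (π ζ') (π ζ'') (π (j c)) =
      Module.length D (D ⧸ ((stalkIdeal (primeDivisorIdeal ζ'') (j c)).comap φ).map (θ.comp φ)) := by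
    rw [pairLength_def, ← comap_stalkMap_stalkIdeal_primeDivisorIdeal π hζ'c,
      ← comap_stalkMap_stalkIdeal_primeDivisorIdeal π hζ''c]
    refine length_quotient_sup_eq_of_surjective (θ.comp φ) hsurj' ?_ _
    rw [← RingHom.comap_ker, hkerθ, ← hP']
  -- the key containment `φ(φ⁻¹ 𝔭″) S ⊆ (t g″)`
  have hkey : ((stalkIdeal (primeDivisorIdeal ζ'') (j c)).comap φ).map φ ≤ Ideal.span {t * g''} := by
    refine le_trans (le_inf Ideal.map_comap_le ?_) (span_singleton_inf_le_span_mul ht htg |>.trans' (by rw [hP'']))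
    rw [← hPE']
    refine Ideal.map_mono (IsLocalRing.le_maximalIdeal ?_)
    exact (Ideal.IsPrime.comap φ (hK := (hP'' ▸ (Ideal.span_singleton_prime hg''.ne_zero).mpr hg''))).ne_top
  have hkey' : ((stalkIdeal (primeDivisorIdeal ζ'') (j c)).comap φ).map (θ.comp φ) ≤
      Ideal.span {θ t} * (Ideal.span {g''}).map θ := by
    rw [← Ideal.map_map, Ideal.map_span, Set.image_singleton, Ideal.span_singleton_mul_span_singleton, ← map_mul,
      ← Set.image_singleton, ← Ideal.map_span]
    exact Ideal.map_mono hkey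
  -- Nakayama on the branch ring
  have hI0 : (Ideal.span {g''}).map θ ≠ ⊥ := by
    rw [Ideal.map_span, Set.image_singleton, Ne, Ideal.span_singleton_eq_bot, ← RingHom.mem_ker, hkerθ,
      Ideal.mem_span_singleton]
    exact hgg
  have hIfg : ((Ideal.span {g''}).map θ).FG := by
    rw [Ideal.map_span, Set.image_singleton]; exact ⟨{θ g''}, by simp⟩
  have hat : θ t ∈ maximalIdeal D := by
    have htm : t ∈ maximalIdeal S := (mem_maximalIdeal _).mpr ht.not_unit
    exact (mem_maximalIdeal _).mpr fun h => (mem_maximalIdeal _).mp htm ((isUnit_map_iff θ t).mp h)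
  rw [hLHS, hRHS]
  exact (length_quotient_add_one_le_of_mul hIfg hI0 hat).trans (length_quotient_antitone hkey')

end Lift

end CampaignW46

end Summit.ResolutionOfSingularities.ResolutionOfSingularities.Theorems

end
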